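import Summits.QuantumFields.BalabanUV.Beta.FP.RoadRowD1
import Summits.QuantumFields.BalabanUV.Beta.FP.PerfectKernelSymmGeneric

/-!
# `BalabanUV.Beta.FP.RoadRowD1Slots` — road «FP» for binder row D1 AT THE LITERAL OF RECORD `RowD1JointEnd.JsRowD1`, row ROWD1-SLOTS (owner ruling
# R-FP-16): the finite-`j` TRANSPOSITION ROW `hTj` of `FP/RoadRowD1` DISCHARGED from the structure of the literal (coarse invariance of the co-dressed
# one-step resolvents, (St♭) of the recursive stencils, (Wt) + bond-swap symmetry of the recursive W-tables — all tree theorems), and the ENDs of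
# `FP/RoadRowD1` §3 ∕ §4 re-issued WITHOUT `hTj`; plus the owner's structural `hTsymm` socket for the perfect one-step kernel of the literal

HONEST DEPENDENCY (page 1, mandatory): continuum YM on T⁴ ⇐ BetaPertH ∧ nine spine estimates (0/9 proved); BetaPertH ⇐ (D1) ∧ (D4) ∧
CAP+tail; G-an2-4 gates asym, D1 and NE2/3/4.  HONEST FRAMING (cell contract, verbatim): «discharging `BetaPertH` makes Bałaban's UV
stability UNCONDITIONAL — a real constructive-QFT result; it is NOT the continuum limit and NOT the Clay problem.»  THIS MODULE is
bookkeeping ∕ plumbing: [folklore] composition BY NAME of leaf-02-g4's `PerfectKernelSymm.hessKer_swap` (through the road FP owner's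
`PerfectKernelSymmGeneric.TGenOf_swap` ∕ `hTsymm_TGenOf_one_dressBmAt`), an2's `AxialDressingRootedBmHessian.decays_coDressKBmAt_KInvStep` ∕
`shiftK_coDressKBmAt_KInvStep`, leaf-10's `WardLocusRecursive.locStencil_SrecAt` ∕ `SrecAt_translate`, an2's `SpineRooted.WrecAt_translate` ∕
`WrecAt_swap`, K-P's `SecondOrderTableLawEnd.vh₂SAn1_translate`, `MixedJetTablesPlug.hmixt_an1`, and leaf-01-g6's `FP/RoadRowD1` ENDs.  No `def`,
no `def … : Prop`, nothing cited, 0 sorry; EVERY row, class datum, letter, `hSDF`, `hasym` of the ENDs stays a HYPOTHESIS; 0∕4 binders of row D1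
(hW, hR, D1Tel, D1Rep) discharged; NOT hW, NOT D1, NOT BetaPertH, NOT continuum, NOT Clay.  ABSOLUTE RULE (cell charter, verbatim): «No
internally-minted statement may enter as a cited fact. Every hypothesis is either kernel-proved in this package or a verbatim quotation of a
PUBLISHED theorem with page reference. The manuscript(s) under audit are NOT citable for their own disputed steps — they are the thing under
adjudication; programme-internal (2001/route/tribunal) claims are never citable.»

WHY.  `FP/RoadRowD1` (p227596) instantiates road FP's generic END at the literal of record with the END's transposition socket `hTsymm` fed by a
finite-`j` ROW `hTj : ∀ j a b t, TbalOf Lc (JsRowD1 …) j a b t = TbalOf Lc (JsRowD1 …) j b a (−t)` left as a hypothesis.  For THIS literal the row is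
a theorem: by the closed form `TbalOf_JsRowD1`, `TbalOf Lc (JsRowD1 …) j = TGenOf Lc G_j G_j S⁰_j W⁰_j` with `G_j = coDressKBmAt ρ_c Lc (KInvStep Lc j)`
(decaying, coarse-invariant), `S⁰_j = SrecAt 3 Lc ρ_c Lc⁴ (−Lc⁸∕2) cΛ j` (local, (St♭)) and `W⁰_j = WrecAt 3 Lc ρ_c … j` ((Wt), bond-swap symmetric),
so `TGenOf_swap` applies at every `j` — NO table hypothesis survives (owner recipe, journal l.17756 (b); R-FP-16).
CONTENT.
* §1 the SHAPE ROWS of the undressed jets `JsRowD1Undressed` of the literal (`rfl` readings of the two tables; (St♭); (Wt); swap; localisation of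
  every stencil member) — one-line instances of the named tree theorems.
* §2 **`TbalOf_JsRowD1_swap`** ∕ **`hTj_JsRowD1`** — the row `hTj` of `FP/RoadRowD1` §2–§4 DISCHARGED, unconditionally, every `j`.
* §3 **`hTsymm_TGenOf_one_JsRowD1`** (any units, K-family pinned at the co-dressed one-step resolvents) and **`hTsymm_TGenOf_one_JsRowD1_bm`** (adopted
  units, `G := GBm ρ_c Lc`, K class datum by `RoadRebasedHoldsBm.hGinf_GBm_holds`) — the owner's structural socket `hTsymm` of
  `StepLawWardGeneric.d1Drift_dressBmAt_of_ward_symm_explicitDefect` ∕ `RoadRebasedHoldsBm.d1Drift_dressBmAt_of_slots_ward_symm_explicitDefect` for the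
  perfect one-step kernel of the literal ⟸ {class data at `m = 1` only}.
* §4 **`d1Drift_JsRowD1_of_rows_wardLetters_explicitDefect`** (any nonzero units; = `RoadRowD1` §3 with `hTj` gone) and
  **`d1Drift_JsRowD1_of_slots_wardLetters_explicitDefect`** (ADOPTED UNITS, K-side discharged; = `RoadRowD1` §4 with `hTj` gone) — RESIDUAL AT THE
  LITERAL OF RECORD, EXACTLY: {pins `hS1`∕`hW1`, the S-slot rows (uniform + Cauchy) on `unitS (sfStep Lc j) (smStep 3 Lc j) (SrecAt 3 Lc ρ_c Lc⁴ (−Lc⁸∕2) cΛ j)`,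
  the W-slot rows on `unitW … (WrecAt … j)`, class data `hSinf`∕`hWinf` (`m ≥ 1`), an1's THREE hW LETTERS (`hBord0`, `hBord0''`, `hM₂0` + `RW₀`
  class∕parity), `hSDF`, `hasym`} — no K-row, no hR letter, no `hTj`∕`hTsymm`.  NOT «D1 closed».
Unit `b2b-balaban-beta-d1-formalise-leaf-01` (gen 7), 2026-08-20; claim table `HOME/b2b-balaban-beta-d1-p3/LEAVES-FP.md` row ROWD1-SLOTS (R-FP-16).
-/

noncomputable section

namespace Summit.QuantumFields.BalabanUV.Beta.FP.RoadRowD1Slots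

open Finset Filter Topology
open scoped BigOperators
open Literature.MathematicalPhysics.QuantumFieldTheory
open Literature.MathematicalPhysics.QuantumFieldTheory.Balaban1983to89
open Literature.MathematicalPhysics.QuantumFieldTheory.Balaban1983to89.Beta
open B12Beta (secondMoment)
open B12Normalization (stepBal)
open DressedMomentNormalisation (EKer dressedEntry)
open ExpKernelCalculus (MKer Decays VertexFamily VertexFamily₂ hessKer comp shiftK)
open KernelWard (divV)
open AffineAveraging (box toSite)
open AveragingContoursRooted (ctr ctrOff ctrOff_mem_box)
open AveragingHessianKernelsRooted (vhSAt)
open AveragingMixedJetTables (mixFFAt)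
open PolarizationSign (WardTransversal)
open OneStepResolventKernel (Fib LocStencil JetData)
open OneStepKernelFamily (vertexOfK KInvStep TbalOf flipK D1Drift)
open WilsonVertex2Sym (wsym22)
open BalabanStepW2 (M2Of)
open Summit.QuantumFields.BalabanUV.Beta.TameKernelCalculus
open Summit.QuantumFields.BalabanUV.Beta.HessKerDressedUnits (unitK unitS unitW)
open Summit.QuantumFields.BalabanUV.Beta.BorderedHessian (diagK stepScale sgnK)
open Summit.QuantumFields.BalabanUV.Beta.AveragingWardRootedStencils (legInd)
open Summit.QuantumFields.BalabanUV.Beta.AxialDressingRooted (dressBmAt coDressKBmAt decays_coDressKBmAt_KInvStep shiftK_coDressKBmAt_KInvStep)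
open Summit.QuantumFields.BalabanUV.Beta.GAN24.CombesThomas (sfStep smStep)
open Summit.QuantumFields.BalabanUV.Beta.WardLocusRecursive (SrecAt locStencil_SrecAt SrecAt_translate)
open Summit.QuantumFields.BalabanUV.Beta.SpineRooted (M1At WrecAt WrecAt_translate WrecAt_swap)
open Summit.QuantumFields.BalabanUV.Beta.MixedJetTablesPlug (hmixt_an1)
open Summit.QuantumFields.BalabanUV.Beta.SecondOrderSocketIdentification (vh₂SAn1)
open Summit.QuantumFields.BalabanUV.Beta.SecondOrderTableLawEnd (vh₂SAn1_translate)
open Summit.QuantumFields.BalabanUV.Beta.RowD1JointEnd (JsRowD1)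
open Summit.QuantumFields.BalabanUV.Beta.FP.PerfectObjectsT (KPerf SPerfOf WPerfOf)
open Summit.QuantumFields.BalabanUV.Beta.FP.TransportInfinityM (colOf)
open Summit.QuantumFields.BalabanUV.Beta.FP.StepDefectInherit (defect)
open Summit.QuantumFields.BalabanUV.Beta.FP.RoadEndGeneric (KPerfOf TGenOf fPerfG)
open Summit.QuantumFields.BalabanUV.Beta.FP.PerfectKernelSymmGeneric (TGenOf_swap hTsymm_TGenOf_one_dressBmAt)
open Summit.QuantumFields.BalabanUV.Beta.FP.RoadRebasedHoldsBm (GBm GBm_one hGinf_GBm_holds)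
open Summit.QuantumFields.BalabanUV.Beta.FP.RoadRowD1 (JsRowD1Undressed TbalOf_JsRowD1
  d1Drift_JsRowD1_of_rows_wardLetters_swapRow_explicitDefect d1Drift_JsRowD1_of_slots_wardLetters_swapRow_explicitDefect)

variable {Lc : ℕ} [NeZero Lc]

/-! ## §1 The shape rows of the undressed jets of the literal of record -/

section Shape

variable (hLc : Odd Lc) (N : ℕ) (cΛ cB : ℝ)

/-- [folklore] The stencil family of the undressed jets IS leaf-10's recursive stencil family `SrecAt` at the centred root and the pins (`rfl`). -/
theorem JsRowD1Undressed_S (j : ℕ) :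
    (JsRowD1Undressed hLc N cΛ cB j).S = SrecAt 3 Lc (toSite (ctrOff (3 + 1) Lc)) ((Lc : ℝ) ^ 4) (-((Lc : ℝ) ^ 8 / 2)) cΛ j := rfl

/-- [folklore] The second-order table of the undressed jets IS an2's W-literal `WrecAt` at the centred root, the pins and an1's tables (`rfl`). -/
theorem JsRowD1Undressed_W (j : ℕ) :
    (JsRowD1Undressed hLc N cΛ cB j).W =
      WrecAt 3 Lc (toSite (ctrOff (3 + 1) Lc)) ((Lc : ℝ) ^ 4) (-((Lc : ℝ) ^ 8 / 2)) cΛ ((Lc : ℝ) ^ 8) cB ((8 * (N : ℝ) ^ 2)⁻¹ • wsym22 N)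
        (vh₂SAn1 Lc) (mixFFAt (toSite (ctrOff (3 + 1) Lc)) Lc) j := rfl

/-- [folklore] **(St♭) OF THE UNDRESSED STENCILS**, every `j` (leaf-10's `SrecAt_translate`). -/
theorem JsRowD1Undressed_S_translate (j : ℕ) (κ : Fin (3 + 1)) (u t : Fin (3 + 1) → ℤ) :
    (JsRowD1Undressed hLc N cΛ cB j).S κ (u + (Lc : ℤ) • t) = shiftK (-((Lc : ℤ) • t)) ((JsRowD1Undressed hLc N cΛ cB j).S κ u) := by
  rw [JsRowD1Undressed_S]
  exact SrecAt_translate (toSite (ctrOff (3 + 1) Lc)) hLc.pos _ _ _ j κ u t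

/-- [folklore] **EVERY UNDRESSED STENCIL MEMBER IS A LOCAL STENCIL FAMILY** (leaf-10's `locStencil_SrecAt`, in-block centred root). -/
theorem locStencil_JsRowD1Undressed_S (j : ℕ) : ∃ Cs δ : ℝ, 0 < δ ∧ LocStencil (JsRowD1Undressed hLc N cΛ cB j).S Cs δ := by
  rw [JsRowD1Undressed_S]
  exact locStencil_SrecAt hLc.pos (ctrOff_mem_box hLc.pos) _ _ _ j

/-- [folklore] **(Wt) OF THE UNDRESSED SECOND-ORDER TABLES**, every `j` (an2's `WrecAt_translate` with K-P's `vh₂SAn1_translate` and `hmixt_an1`). -/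
theorem JsRowD1Undressed_W_translate (j : ℕ) (μ : Fin (3 + 1)) (y : Fin (3 + 1) → ℤ) (ν : Fin (3 + 1)) (y' t : Fin (3 + 1) → ℤ) :
    (JsRowD1Undressed hLc N cΛ cB j).W μ (y + t) ν (y' + t) = shiftK (-((Lc : ℤ) • t)) ((JsRowD1Undressed hLc N cΛ cB j).W μ y ν y') := by
  rw [JsRowD1Undressed_W]
  exact WrecAt_translate _ _ _ _ _ _ _ _ _ hLc.pos (vh₂SAn1_translate hLc.pos) (hmixt_an1 (toSite (ctrOff (3 + 1) Lc))) j μ y ν y' t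

/-- [folklore] **BOND-SWAP SYMMETRY OF THE UNDRESSED SECOND-ORDER TABLES**, every `j` (an2's `WrecAt_swap`). -/
theorem JsRowD1Undressed_W_swap (j : ℕ) (μ : Fin (3 + 1)) (y : Fin (3 + 1) → ℤ) (ν : Fin (3 + 1)) (y' : Fin (3 + 1) → ℤ) :
    (JsRowD1Undressed hLc N cΛ cB j).W μ y ν y' = (JsRowD1Undressed hLc N cΛ cB j).W ν y' μ y := by
  rw [JsRowD1Undressed_W]
  exact (WrecAt_swap _ _ _ _ _ _ _ _ _ j μ y ν y').symm

end Shape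

/-! ## §2 `hTj` DISCHARGED: the wall kernels of the literal of record are transposition-symmetric at every `j` -/

/-- [folklore] **THE TRANSPOSITION ROW OF THE LITERAL OF RECORD IS A THEOREM**: for every `j`, `a`, `b`, `t`,
`TbalOf Lc (JsRowD1 hLc N cΛ cB) j a b t = TbalOf Lc (JsRowD1 hLc N cΛ cB) j b a (−t)` — the closed form `TbalOf_JsRowD1` + the owner's `TGenOf_swap`
fed with the decay ∕ coarse invariance of `coDressKBmAt ρ_c Lc (KInvStep Lc j)` and the §1 shape rows.  No hypothesis. -/
theorem TbalOf_JsRowD1_swap (hLc : Odd Lc) (N : ℕ) (cΛ cB : ℝ) (j : ℕ) (a b : Fin (3 + 1)) (t : Fin (3 + 1) → ℤ) :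
    TbalOf Lc (JsRowD1 hLc N cΛ cB) j a b t = TbalOf Lc (JsRowD1 hLc N cΛ cB) j b a (-t) := by
  obtain ⟨δ, C, hδ, hC, hG⟩ := decays_coDressKBmAt_KInvStep (d := 3) (ctrOff_mem_box hLc.pos) j
  obtain ⟨Cs, δs, hδs, hS⟩ := locStencil_JsRowD1Undressed_S hLc N cΛ cB j
  have key := TGenOf_swap (n := Lc) hG hδ (fun s => shiftK_coDressKBmAt_KInvStep (d := 3) (toSite (ctrOff (3 + 1) Lc)) j s)
    ⟨δ, C, hδ, hC, hG⟩ (fun s => shiftK_coDressKBmAt_KInvStep (d := 3) (toSite (ctrOff (3 + 1) Lc)) j s) hS hδs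
    (fun κ u s => JsRowD1Undressed_S_translate hLc N cΛ cB j κ u s)
    (fun μ y ν y' s => JsRowD1Undressed_W_translate hLc N cΛ cB j μ y ν y' s)
    (fun μ y ν y' => JsRowD1Undressed_W_swap hLc N cΛ cB j μ y ν y') a b t
  rw [TbalOf_JsRowD1]
  exact key

/-- [folklore] **THE ROW `hTj` OF `FP/RoadRowD1` §2–§4 FOR THE LITERAL OF RECORD, LITERALLY** (`TbalOf_JsRowD1_swap` packaged in the binder's shape). -/
theorem hTj_JsRowD1 (hLc : Odd Lc) (N : ℕ) (cΛ cB : ℝ) :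
    ∀ (j : ℕ) (a b : Fin (3 + 1)) (t : Fin (3 + 1) → ℤ),
      TbalOf Lc (JsRowD1 hLc N cΛ cB) j a b t = TbalOf Lc (JsRowD1 hLc N cΛ cB) j b a (-t) :=
  fun j a b t => TbalOf_JsRowD1_swap hLc N cΛ cB j a b t

/-! ## §3 The owner's structural socket `hTsymm` for the perfect one-step kernel of the literal -/

section Symm

variable (hLc : Odd Lc) (N : ℕ) (cΛ cB : ℝ) (sf sm : ℕ → ℝ) (G : ℕ → ℕ → MKer (3 + 1) (Fib 3))
  (S : ℕ → ℕ → Fin (3 + 1) → (Fin (3 + 1) → ℤ) → MKer (3 + 1) (Fib 3))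
  (Wt : ℕ → ℕ → Fin (3 + 1) → (Fin (3 + 1) → ℤ) → Fin (3 + 1) → (Fin (3 + 1) → ℤ) → MKer (3 + 1) (Fib 3))

/-- [folklore] **`hTsymm` FOR THE PERFECT ONE-STEP KERNEL OF THE LITERAL OF RECORD** (any units; K-family pinned at the co-dressed one-step resolvents,
stencil ∕ table families pinned at the undressed jets): the owner's `PerfectKernelSymmGeneric.hTsymm_TGenOf_one_dressBmAt` with its three shape rows
(St♭) ∕ (Wt) ∕ swap DISCHARGED by §1 — ⟸ {decay of `KPerfOf … G 1`, localisation of `SPerfOf … 1`} only (class data at `m = 1`). -/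
theorem hTsymm_TGenOf_one_JsRowD1
    (hG1 : ∀ j, G j 1 = coDressKBmAt (toSite (ctrOff (3 + 1) Lc)) Lc (KInvStep (d := 3) Lc j))
    (hS1 : ∀ j, S j 1 = (JsRowD1Undressed hLc N cΛ cB j).S) (hW1 : ∀ j, Wt j 1 = (JsRowD1Undressed hLc N cΛ cB j).W)
    {C δ : ℝ} (hGinf : Decays (KPerfOf (d := 3) sf sm G 1) C δ) (hδ : 0 < δ)
    {Cs δs : ℝ} (hSinf : LocStencil (SPerfOf sf sm S 1) Cs δs) (hδs : 0 < δs)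
    (a b : Fin (3 + 1)) (t : Fin (3 + 1) → ℤ) :
    TGenOf Lc (KPerfOf sf sm G 1) (KPerfOf sf sm G 1) (SPerfOf sf sm S 1) (WPerfOf sf sm Wt 1) a b t
      = TGenOf Lc (KPerfOf sf sm G 1) (KPerfOf sf sm G 1) (SPerfOf sf sm S 1) (WPerfOf sf sm Wt 1) b a (-t) :=
  hTsymm_TGenOf_one_dressBmAt (JsRowD1Undressed hLc N cΛ cB) sf sm G S Wt hG1 hS1 hW1 hGinf hδ hSinf hδs
    (fun j κ u s => JsRowD1Undressed_S_translate hLc N cΛ cB j κ u s)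
    (fun j μ y ν y' s => JsRowD1Undressed_W_translate hLc N cΛ cB j μ y ν y' s)
    (fun j μ y ν y' => JsRowD1Undressed_W_swap hLc N cΛ cB j μ y ν y') a b t

/-- [folklore] **… IN THE ADOPTED UNITS WITH THE K CLASS DATUM DISCHARGED** (`2 ≤ Lc`; `sf := sfStep Lc`, `sm := smStep 3 Lc`, `G := GBm ρ_c Lc`,
pin `GBm_one`, decay of `KPerfOf … (GBm ρ_c Lc) 1` by `RoadRebasedHoldsBm.hGinf_GBm_holds`): the socket `hTsymm` of
`RoadRebasedHoldsBm.d1Drift_dressBmAt_of_slots_ward_symm_explicitDefect` at `Js⁰ := JsRowD1Undressed …` ⟸ {localisation of `SPerfOf … S 1`} only. -/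
theorem hTsymm_TGenOf_one_JsRowD1_bm (hLc2 : 2 ≤ Lc)
    (hS1 : ∀ j, S j 1 = (JsRowD1Undressed hLc N cΛ cB j).S) (hW1 : ∀ j, Wt j 1 = (JsRowD1Undressed hLc N cΛ cB j).W)
    (hSinf1 : ∃ Cs δs : ℝ, 0 < δs ∧ LocStencil (SPerfOf (sfStep Lc) (smStep 3 Lc) S 1) Cs δs)
    (a b : Fin (3 + 1)) (t : Fin (3 + 1) → ℤ) :
    TGenOf Lc (KPerfOf (sfStep Lc) (smStep 3 Lc) (GBm (ctrOff (3 + 1) Lc) Lc) 1) (KPerfOf (sfStep Lc) (smStep 3 Lc) (GBm (ctrOff (3 + 1) Lc) Lc) 1)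
        (SPerfOf (sfStep Lc) (smStep 3 Lc) S 1) (WPerfOf (sfStep Lc) (smStep 3 Lc) Wt 1) a b t
      = TGenOf Lc (KPerfOf (sfStep Lc) (smStep 3 Lc) (GBm (ctrOff (3 + 1) Lc) Lc) 1) (KPerfOf (sfStep Lc) (smStep 3 Lc) (GBm (ctrOff (3 + 1) Lc) Lc) 1)
        (SPerfOf (sfStep Lc) (smStep 3 Lc) S 1) (WPerfOf (sfStep Lc) (smStep 3 Lc) Wt 1) b a (-t) := by
  obtain ⟨δ, C, hδ, -, hG⟩ := hGinf_GBm_holds hLc2 (ctrOff_mem_box hLc.pos) 1 le_rfl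
  obtain ⟨Cs, δs, hδs, hS⟩ := hSinf1
  exact hTsymm_TGenOf_one_JsRowD1 hLc N cΛ cB (sfStep Lc) (smStep 3 Lc) (GBm (ctrOff (3 + 1) Lc) Lc) S Wt (GBm_one _ Lc) hS1 hW1 hG hδ hS hδs
    a b t

end Symm

/-! ## §4 The ENDs of `FP/RoadRowD1` with the transposition row gone -/

section End

variable (hLc : Odd Lc) (N : ℕ) (cΛ cB : ℝ) (sf sm : ℕ → ℝ) (G : ℕ → ℕ → MKer (3 + 1) (Fib 3))
  (S : ℕ → ℕ → Fin (3 + 1) → (Fin (3 + 1) → ℤ) → MKer (3 + 1) (Fib 3))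
  (Wt : ℕ → ℕ → Fin (3 + 1) → (Fin (3 + 1) → ℤ) → Fin (3 + 1) → (Fin (3 + 1) → ℤ) → MKer (3 + 1) (Fib 3))
  {R C cK δK Cs cS δS Cw cW δW θ : ℝ}

/-- **ROAD «FP» AT THE LITERAL OF RECORD, THE WARD ROW FROM an1's THREE LEVEL-0 WARD LETTERS, THE TRANSPOSITION ROW DISCHARGED** (`2 ≤ N`,
`2 ≤ Lc`, odd `Lc`; any nonzero units): `RoadRowD1.d1Drift_JsRowD1_of_rows_wardLetters_swapRow_explicitDefect` with `hTj := hTj_JsRowD1`.  Residual: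
{nonzero units; K-family pinned at the co-dressed one-step resolvents with its Cauchy rows and window; S-∕W-slot rows of the undressed jets; class data
`m ≥ 1`; an1's THREE hW LETTERS; hSDF; hasym}.  NOT «D1 closed». [our object] -/
theorem d1Drift_JsRowD1_of_rows_wardLetters_explicitDefect (hLc2 : 2 ≤ Lc) (hN : 2 ≤ N)
    (hsf : ∀ j, sf j ≠ 0) (hsm : ∀ j, sm j ≠ 0)
    (hG1 : ∀ j, G j 1 = coDressKBmAt (toSite (ctrOff (3 + 1) Lc)) Lc (KInvStep (d := 3) Lc j))
    (hS1 : ∀ j, S j 1 = (JsRowD1Undressed hLc N cΛ cB j).S) (hW1 : ∀ j, Wt j 1 = (JsRowD1Undressed hLc N cΛ cB j).W)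
    (hK : ∀ j, Decays (unitK (sf j) (sm j) (coDressKBmAt (toSite (ctrOff (3 + 1) Lc)) Lc (KInvStep (d := 3) Lc j))) C δK)
    (hKall : ∀ k j, Decays (unitK (sf (k + j)) (sm (k + j)) (coDressKBmAt (toSite (ctrOff (3 + 1) Lc)) Lc (KInvStep (d := 3) Lc (k + j))) -
      unitK (sf k) (sm k) (coDressKBmAt (toSite (ctrOff (3 + 1) Lc)) Lc (KInvStep (d := 3) Lc k))) (cK * θ ^ k) δK)
    (hS : ∀ j, LocStencil (unitS (sf j) (sm j) (JsRowD1Undressed hLc N cΛ cB j).S) Cs δS)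
    (hSall : ∀ k j, LocStencil (unitS (sf (k + j)) (sm (k + j)) (JsRowD1Undressed hLc N cΛ cB (k + j)).S -
      unitS (sf k) (sm k) (JsRowD1Undressed hLc N cΛ cB k).S) (cS * θ ^ k) δS)
    (hW : ∀ j, VertexFamily₂ (unitW (sf j) (sm j) (JsRowD1Undressed hLc N cΛ cB j).W) Lc Cw δW)
    (hWall : ∀ k j, VertexFamily₂ (unitW (sf (k + j)) (sm (k + j)) (JsRowD1Undressed hLc N cΛ cB (k + j)).W -
      unitW (sf k) (sm k) (JsRowD1Undressed hLc N cΛ cB k).W) Lc (cW * θ ^ k) δW)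
    (hR : 0 < R) (hRK : R < δK) (hRS : R / 2 < δS) (hRW : R < δW) (hθ0 : 0 ≤ θ) (hθ1 : θ < 1)
    (hGinf : ∀ m : ℕ, 1 ≤ m → ∃ δ C : ℝ, 0 < δ ∧ 0 ≤ C ∧ Decays (KPerfOf (d := 3) sf sm G m) C δ)
    (hSinf : ∀ m : ℕ, 1 ≤ m → ∃ Cs δS : ℝ, 0 < δS ∧ LocStencil (SPerfOf sf sm S m) Cs δS)
    (hWinf : ∀ m : ℕ, 1 ≤ m → ∃ Cw δW : ℝ, 0 < δW ∧ VertexFamily₂ (WPerfOf sf sm Wt m) (Lc ^ m) Cw δW)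
    -- an1's three level-0 hW LETTERS (K-Q's shapes VERBATIM)
    {RW₀ : (Fin (3 + 1) → ℤ) → Fin (3 + 1) → (Fin (3 + 1) → ℤ) → MKer (3 + 1) (Fib 3)}
    (hclsW₀ : ∃ C δ : ℝ, 0 < δ ∧ ∀ y, VertexFamily (RW₀ y) Lc C δ)
    (hRW₀p : ∀ y ρ' w, trK (RW₀ y ρ' w) = -sgnK (RW₀ y ρ' w))
    (hBord0 : ∀ (Y : Fin (3 + 1) → ℤ) (κ' : Fin (3 + 1)) (u' : Fin (3 + 1) → ℤ),
      (stepScale 3 Lc 0 * (Lc : ℝ) ^ (3 + 1))⁻¹ • ∑ v ∈ box (3 + 1) Lc, divV (fun κ u => cB • vh₂SAn1 Lc κ u κ' u') ((Lc : ℤ) • Y + toSite v) =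
        comp ((-((Lc : ℝ) ^ (3 + 1) * (1 / 2) * (Lc : ℝ) ^ (3 + 1))) • vhSAt (toSite (ctrOff 4 Lc)) 3 Lc rfl κ' u')
            (diagK (((1 : ℝ) / 2) • ∑ v ∈ box (3 + 1) Lc, legInd (toSite (ctrOff 4 Lc)) ((Lc : ℤ) • Y + toSite v)))
          - comp (diagK (((1 : ℝ) / 2) • ∑ v ∈ box (3 + 1) Lc, legInd (toSite (ctrOff 4 Lc)) ((Lc : ℤ) • Y + toSite v)))
            ((-((Lc : ℝ) ^ (3 + 1) * (1 / 2) * (Lc : ℝ) ^ (3 + 1))) • vhSAt (toSite (ctrOff 4 Lc)) 3 Lc rfl κ' u'))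
    (hBord0'' : ∀ (Y : Fin (3 + 1) → ℤ) (κ : Fin (3 + 1)) (u : Fin (3 + 1) → ℤ),
      (stepScale 3 Lc 0 * (Lc : ℝ) ^ (3 + 1))⁻¹ • ∑ v ∈ box (3 + 1) Lc, divV (fun κ' u' => cB • vh₂SAn1 Lc κ u κ' u') ((Lc : ℤ) • Y + toSite v) =
        comp ((-((Lc : ℝ) ^ (3 + 1) * (1 / 2) * (Lc : ℝ) ^ (3 + 1))) • vhSAt (toSite (ctrOff 4 Lc)) 3 Lc rfl κ u)
            (diagK (((1 : ℝ) / 2) • ∑ v ∈ box (3 + 1) Lc, legInd (toSite (ctrOff 4 Lc)) ((Lc : ℤ) • Y + toSite v)))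
          - comp (diagK (((1 : ℝ) / 2) • ∑ v ∈ box (3 + 1) Lc, legInd (toSite (ctrOff 4 Lc)) ((Lc : ℤ) • Y + toSite v)))
            ((-((Lc : ℝ) ^ (3 + 1) * (1 / 2) * (Lc : ℝ) ^ (3 + 1))) • vhSAt (toSite (ctrOff 4 Lc)) 3 Lc rfl κ u))
    (hM₂0 : ∀ (y : Fin (3 + 1) → ℤ) (ρ' : Fin (3 + 1)) (w : Fin (3 + 1) → ℤ),
      (stepScale 3 Lc 0 * (Lc : ℝ) ^ (3 + 1))⁻¹ • ∑ v ∈ box (3 + 1) Lc,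
          divV (fun κ u => M2Of 3 Lc (mixFFAt (toSite (ctrOff 4 Lc)) Lc) 0 κ u ρ' w) ((Lc : ℤ) • y + toSite v) =
        comp (M1At 3 Lc (toSite (ctrOff 4 Lc)) cΛ 0 ρ' w) (diagK (((1 : ℝ) / 2) • ∑ v ∈ box (3 + 1) Lc, legInd (toSite (ctrOff 4 Lc)) ((Lc : ℤ) • y + toSite v)))
          - comp (diagK (((1 : ℝ) / 2) • ∑ v ∈ box (3 + 1) Lc, legInd (toSite (ctrOff 4 Lc)) ((Lc : ℤ) • y + toSite v)))
            (M1At 3 Lc (toSite (ctrOff 4 Lc)) cΛ 0 ρ' w)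
          + RW₀ y ρ' w)
    (μ ν : Fin 4)
    (hSDF : ∀ m : ℕ, 1 ≤ m → secondMoment (defect
      (fun m => TGenOf (Lc ^ m) (KPerfOf sf sm G m) (KPerfOf sf sm G m) (SPerfOf sf sm S m) (WPerfOf sf sm Wt m))
      (fun m a b z => ((Lc ^ m : ℕ) : ℝ) ^ 8 * dressedEntry (colOf (KPerf (d := 3) Lc (sfStep Lc) (smStep 3 Lc) m))
        (TGenOf Lc (KPerfOf sf sm G 1) (KPerfOf sf sm G 1) (SPerfOf sf sm S 1) (WPerfOf sf sm Wt 1))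
        (((Lc ^ m : ℕ) : ℤ) • z) a b) m) μ ν = 0)
    {Nc Cg : ℝ} (hasym : ∀ m : ℕ, 1 ≤ m → |fPerfG Lc sf sm G G S Wt μ ν m - (m : ℝ) * stepBal Nc Lc| ≤ Cg) :
    D1Drift Lc (JsRowD1 hLc N cΛ cB) Nc μ ν :=
  d1Drift_JsRowD1_of_rows_wardLetters_swapRow_explicitDefect hLc N cΛ cB sf sm G S Wt hLc2 hN hsf hsm hG1 hS1 hW1 hK hKall hS hSall hW hWall
    hR hRK hRS hRW hθ0 hθ1 hGinf hSinf hWinf hclsW₀ hRW₀p hBord0 hBord0'' hM₂0 (hTj_JsRowD1 hLc N cΛ cB) μ ν hSDF hasym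

/-- **ROAD «FP» AT THE LITERAL OF RECORD, ADOPTED UNITS, K-SIDE + WARD ROW + TRANSPOSITION ROW DISCHARGED** (`2 ≤ N`, `2 ≤ Lc`, odd `Lc`;
`sf := sfStep Lc`, `sm := smStep 3 Lc`, `G := GBm ρ_c Lc`): `RoadRowD1.d1Drift_JsRowD1_of_slots_wardLetters_swapRow_explicitDefect` with `hTj := hTj_JsRowD1`
— the deliverable of row ROWD1-SLOTS (R-FP-16).  RESIDUAL AT THE LITERAL OF RECORD, EXACTLY: {pins `hS1`∕`hW1`; the S-slot rows (uniform `hS` + Cauchy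
`hSall`, own rate `θS`) on `unitS (sfStep Lc j) (smStep 3 Lc j) (SrecAt 3 Lc ρ_c Lc⁴ (−Lc⁸∕2) cΛ j)`; the W-slot rows (`hW`, `hWall`, own rate `θW`) on
`unitW … (WrecAt 3 Lc ρ_c … j)`; `0 < δS`, `0 < δW`; class data `hSinf`∕`hWinf` (`m ≥ 1`); an1's THREE hW LETTERS (`hBord0`, `hBord0''`, `hM₂0` with `RW₀` of
`VertexFamily` class, row-parity-odd); `hSDF`; `hasym`} — no K-row, no hR letter, no `hTj`, no `hTsymm`.  NOT «D1 closed»; 0∕4 row-D1 binders. [our object] -/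
theorem d1Drift_JsRowD1_of_slots_wardLetters_explicitDefect (hLc2 : 2 ≤ Lc) (hN : 2 ≤ N) {θS θW : ℝ}
    (hS1 : ∀ j, S j 1 = (JsRowD1Undressed hLc N cΛ cB j).S) (hW1 : ∀ j, Wt j 1 = (JsRowD1Undressed hLc N cΛ cB j).W)
    (hS : ∀ j, LocStencil (unitS (sfStep Lc j) (smStep 3 Lc j) (JsRowD1Undressed hLc N cΛ cB j).S) Cs δS)
    (hSall : ∀ k j, LocStencil (unitS (sfStep Lc (k + j)) (smStep 3 Lc (k + j)) (JsRowD1Undressed hLc N cΛ cB (k + j)).S -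
      unitS (sfStep Lc k) (smStep 3 Lc k) (JsRowD1Undressed hLc N cΛ cB k).S) (cS * θS ^ k) δS)
    (hW : ∀ j, VertexFamily₂ (unitW (sfStep Lc j) (smStep 3 Lc j) (JsRowD1Undressed hLc N cΛ cB j).W) Lc Cw δW)
    (hWall : ∀ k j, VertexFamily₂ (unitW (sfStep Lc (k + j)) (smStep 3 Lc (k + j)) (JsRowD1Undressed hLc N cΛ cB (k + j)).W -
      unitW (sfStep Lc k) (smStep 3 Lc k) (JsRowD1Undressed hLc N cΛ cB k).W) Lc (cW * θW ^ k) δW)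
    (hδS : 0 < δS) (hδW : 0 < δW) (hθS0 : 0 ≤ θS) (hθS1 : θS < 1) (hθW0 : 0 ≤ θW) (hθW1 : θW < 1)
    (hSinf : ∀ m : ℕ, 1 ≤ m → ∃ Cs' δS' : ℝ, 0 < δS' ∧ LocStencil (SPerfOf (sfStep Lc) (smStep 3 Lc) S m) Cs' δS')
    (hWinf : ∀ m : ℕ, 1 ≤ m → ∃ Cw' δW' : ℝ, 0 < δW' ∧ VertexFamily₂ (WPerfOf (sfStep Lc) (smStep 3 Lc) Wt m) (Lc ^ m) Cw' δW')
    -- an1's three level-0 hW LETTERS (K-Q's shapes VERBATIM)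
    {RW₀ : (Fin (3 + 1) → ℤ) → Fin (3 + 1) → (Fin (3 + 1) → ℤ) → MKer (3 + 1) (Fib 3)}
    (hclsW₀ : ∃ C δ : ℝ, 0 < δ ∧ ∀ y, VertexFamily (RW₀ y) Lc C δ)
    (hRW₀p : ∀ y ρ' w, trK (RW₀ y ρ' w) = -sgnK (RW₀ y ρ' w))
    (hBord0 : ∀ (Y : Fin (3 + 1) → ℤ) (κ' : Fin (3 + 1)) (u' : Fin (3 + 1) → ℤ),
      (stepScale 3 Lc 0 * (Lc : ℝ) ^ (3 + 1))⁻¹ • ∑ v ∈ box (3 + 1) Lc, divV (fun κ u => cB • vh₂SAn1 Lc κ u κ' u') ((Lc : ℤ) • Y + toSite v) =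
        comp ((-((Lc : ℝ) ^ (3 + 1) * (1 / 2) * (Lc : ℝ) ^ (3 + 1))) • vhSAt (toSite (ctrOff 4 Lc)) 3 Lc rfl κ' u')
            (diagK (((1 : ℝ) / 2) • ∑ v ∈ box (3 + 1) Lc, legInd (toSite (ctrOff 4 Lc)) ((Lc : ℤ) • Y + toSite v)))
          - comp (diagK (((1 : ℝ) / 2) • ∑ v ∈ box (3 + 1) Lc, legInd (toSite (ctrOff 4 Lc)) ((Lc : ℤ) • Y + toSite v)))
            ((-((Lc : ℝ) ^ (3 + 1) * (1 / 2) * (Lc : ℝ) ^ (3 + 1))) • vhSAt (toSite (ctrOff 4 Lc)) 3 Lc rfl κ' u'))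
    (hBord0'' : ∀ (Y : Fin (3 + 1) → ℤ) (κ : Fin (3 + 1)) (u : Fin (3 + 1) → ℤ),
      (stepScale 3 Lc 0 * (Lc : ℝ) ^ (3 + 1))⁻¹ • ∑ v ∈ box (3 + 1) Lc, divV (fun κ' u' => cB • vh₂SAn1 Lc κ u κ' u') ((Lc : ℤ) • Y + toSite v) =
        comp ((-((Lc : ℝ) ^ (3 + 1) * (1 / 2) * (Lc : ℝ) ^ (3 + 1))) • vhSAt (toSite (ctrOff 4 Lc)) 3 Lc rfl κ u)
            (diagK (((1 : ℝ) / 2) • ∑ v ∈ box (3 + 1) Lc, legInd (toSite (ctrOff 4 Lc)) ((Lc : ℤ) • Y + toSite v)))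
          - comp (diagK (((1 : ℝ) / 2) • ∑ v ∈ box (3 + 1) Lc, legInd (toSite (ctrOff 4 Lc)) ((Lc : ℤ) • Y + toSite v)))
            ((-((Lc : ℝ) ^ (3 + 1) * (1 / 2) * (Lc : ℝ) ^ (3 + 1))) • vhSAt (toSite (ctrOff 4 Lc)) 3 Lc rfl κ u))
    (hM₂0 : ∀ (y : Fin (3 + 1) → ℤ) (ρ' : Fin (3 + 1)) (w : Fin (3 + 1) → ℤ),
      (stepScale 3 Lc 0 * (Lc : ℝ) ^ (3 + 1))⁻¹ • ∑ v ∈ box (3 + 1) Lc,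
          divV (fun κ u => M2Of 3 Lc (mixFFAt (toSite (ctrOff 4 Lc)) Lc) 0 κ u ρ' w) ((Lc : ℤ) • y + toSite v) =
        comp (M1At 3 Lc (toSite (ctrOff 4 Lc)) cΛ 0 ρ' w) (diagK (((1 : ℝ) / 2) • ∑ v ∈ box (3 + 1) Lc, legInd (toSite (ctrOff 4 Lc)) ((Lc : ℤ) • y + toSite v)))
          - comp (diagK (((1 : ℝ) / 2) • ∑ v ∈ box (3 + 1) Lc, legInd (toSite (ctrOff 4 Lc)) ((Lc : ℤ) • y + toSite v)))
            (M1At 3 Lc (toSite (ctrOff 4 Lc)) cΛ 0 ρ' w)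
          + RW₀ y ρ' w)
    (μ ν : Fin 4)
    (hSDF : ∀ m : ℕ, 1 ≤ m → secondMoment (defect
      (fun m => TGenOf (Lc ^ m) (KPerfOf (sfStep Lc) (smStep 3 Lc) (GBm (ctrOff (3 + 1) Lc) Lc) m)
        (KPerfOf (sfStep Lc) (smStep 3 Lc) (GBm (ctrOff (3 + 1) Lc) Lc) m)
        (SPerfOf (sfStep Lc) (smStep 3 Lc) S m) (WPerfOf (sfStep Lc) (smStep 3 Lc) Wt m))
      (fun m a b z => ((Lc ^ m : ℕ) : ℝ) ^ 8 * dressedEntry (colOf (KPerf (d := 3) Lc (sfStep Lc) (smStep 3 Lc) m))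
        (TGenOf Lc (KPerfOf (sfStep Lc) (smStep 3 Lc) (GBm (ctrOff (3 + 1) Lc) Lc) 1)
          (KPerfOf (sfStep Lc) (smStep 3 Lc) (GBm (ctrOff (3 + 1) Lc) Lc) 1)
          (SPerfOf (sfStep Lc) (smStep 3 Lc) S 1) (WPerfOf (sfStep Lc) (smStep 3 Lc) Wt 1))
        (((Lc ^ m : ℕ) : ℤ) • z) a b) m) μ ν = 0)
    {Nc Cg : ℝ}
    (hasym : ∀ m : ℕ, 1 ≤ m →
      |fPerfG Lc (sfStep Lc) (smStep 3 Lc) (GBm (ctrOff (3 + 1) Lc) Lc) (GBm (ctrOff (3 + 1) Lc) Lc) S Wt μ ν m - (m : ℝ) * stepBal Nc Lc| ≤ Cg) :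
    D1Drift Lc (JsRowD1 hLc N cΛ cB) Nc μ ν :=
  d1Drift_JsRowD1_of_slots_wardLetters_swapRow_explicitDefect hLc N cΛ cB S Wt hLc2 hN hS1 hW1 hS hSall hW hWall hδS hδW hθS0 hθS1 hθW0 hθW1
    hSinf hWinf hclsW₀ hRW₀p hBord0 hBord0'' hM₂0 (hTj_JsRowD1 hLc N cΛ cB) μ ν hSDF hasym

end End

end Summit.QuantumFields.BalabanUV.Beta.FP.RoadRowD1Slots

end
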